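import Summits.AnomalousDissipation.AnomalousDissipation.Theorems.SolenoidalFractalHomogenisationLagrangianStepSidebandXDefectAlgebra
import Summits.AnomalousDissipation.AnomalousDissipation.Theorems.SolenoidalFractalHomogenisationLagrangianStepSidebandResponseUnique
import HarnessLib

/-!
# K1L_D `LagrangianRenormalisationStepDesign` (stmt-AnomalousDissipation-27980), `stub_D1_V0` (V0 = clause (ii) of
# `WCrossing.D1ExactFamily`), brick T4c-3 (pairings): the VISCOUS DEFECT PAIRED WITH A CLASS-TRANSVERSAL RESIDUAL, and the `ℓ²` SHIFT
# BOOKKEEPING that sums per-neighbour link bounds over the box (helper; `--kind proof --supports stmt-AnomalousDissipation-27980 --as helper`)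

Summits-side helper file of route `SolenoidalFractalHomogenisation` (prover seat `ad-k1l-cellLawV-w1` g6).  Everything proved; no definitions, no named
facts, no sorry.  Glue between the componentwise defect identity (`…SidebandXDefectCommutator.genX_projX_sub_projX_gen_apply`), its bounds
(`…DefectAlgebra.abs_re_visc_defect_le`, `…DefectLinks`) and the energy inequality `…SidebandXResidual.two_inner_genX_add_le` (which pairs with `r`
componentwise, `real_inner_space_eq_sum`):
* **`abs_re_inner_visc_defect_le`** — for `P_{k_z} r_z = r_z` and ALL `y_z`:
  `|Re⟪r_z, 4π²•(P_k T_{((1/n²)𝔸)ᵀ}(k) P_k y_z − P_k P_z T_{𝔸ᵀ}(z) P_z y_z)⟫| ≤ 4π²·534·K₀·√|z|²·(√|ℓ|²/n)·‖y_z‖‖r_z‖` (`K₀` a transverse bound of `bsymb 𝔸ᵀ`,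
  `z ≠ 0`, `4|ℓ|² ≤ n²|z|²`) — the form in which the viscous group of D1 meets the dissipation weight `|k_z|²‖r_z‖²`;
* `norm_sq_coordL_eq_sum`, **`sum_norm_sq_coordL_sub_le`** / `…_add_le` — `Σ_z ‖coordL_{z∓m} y‖² ≤ ‖y‖²` (a shift reads every amplitude at most once);
* **`sum_norm_mul_norm_coordL_sub_le`** / `…_add_le` — `Σ_z ‖r_z‖·‖coordL_{z∓m} y‖ ≤ ‖r‖·‖y‖` (Cauchy–Schwarz + shift): with `…DefectLinks.norm_slow_link_le` /
  `norm_link_commutator_le` the two link groups of D1 pair with `r` as `≤ 2·(Σⱼ cⱼ)·ξ·‖r‖‖y‖`, `cⱼ = 2π‖αⱼ‖(5 + 3|mⱼ|)`.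
NOT a proof of any registered stub, of K1L_D, or of anomalous dissipation; rung F-D1.A0 infrastructure.
-/

set_option linter.dupNamespace false

noncomputable section

namespace Summit.AnomalousDissipation.AnomalousDissipation.Theorems.SolenoidalFractalHomogenisation.LagrangianStep.Sideband

open Set MeasureTheory Complex UnitAddTorus
open scoped InnerProductSpace
open Literature.Analysis Literature.Analysis.FunctionSpaces Literature.Analysis.FunctionSpaces.Torus
open Literature.Analysis.FluidPDE Literature.Analysis.FluidPDE.Torus Literature.Analysis.FluidPDE.LatticeShear

variable {k₀ : ℕ}

/-! ## §1 The viscous defect paired with a class-transversal residual -/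

/-- **The viscous group of D1 against `r_z`** (`P_{k_z} r_z = r_z`): bounded by `4π²·534·K₀·√|z|²·(√|ℓ|²/n)·‖y_z‖‖r_z‖`.
[cite: Frisch1995Turbulence, §9.6.3 eq. (9.57) p. 233] -/
theorem abs_re_inner_visc_defect_le {𝔸 : Torus.Visc4 (Fin 3)} {K₀ : ℝ} (hK₀ : 0 ≤ K₀)
    (hK : ∀ k p q : Fin 3 → ℝ, ∑ i, p i * k i = 0 → ∑ i, q i * k i = 0 →
      |Torus.bsymb (Torus.majorTranspose 𝔸) k p q| ≤ K₀ * (∑ a, k a ^ 2) * (Real.sqrt (∑ i, p i ^ 2) * Real.sqrt (∑ i, q i ^ 2)))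
    {n : ℕ} (hn : n ≠ 0) (ℓ : Fin 3 → ℤ) {z : Fin 3 → ℤ} (hz : z ≠ 0) (hclose : 4 * freqNormSq ℓ ≤ (n : ℝ) ^ 2 * freqNormSq z)
    {r : EuclideanSpace ℂ (Fin 3)} (hr : transversalProj (classFreq n ℓ z) r = r) (y : EuclideanSpace ℂ (Fin 3)) :
    |(⟪r, (((4 * Real.pi ^ 2 : ℝ) : ℂ)) • (transversalProj (classFreq n ℓ z)
          (Torus.symbT (Torus.majorTranspose ((1 / (n : ℝ) ^ 2) • 𝔸)) (classFreq n ℓ z) (transversalProj (classFreq n ℓ z) y)) -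
        transversalProj (classFreq n ℓ z) (transversalProj z (Torus.symbT (Torus.majorTranspose 𝔸) z (transversalProj z y))))⟫_ℂ).re| ≤
      4 * Real.pi ^ 2 * (534 * K₀ * Real.sqrt (freqNormSq z) * (Real.sqrt (freqNormSq ℓ) / n) * (‖y‖ * ‖r‖)) := by
  have h := abs_re_visc_defect_le hK₀ hK hn ℓ hz hclose r y
  rw [Torus.majorTranspose_smul]
  -- move the projections onto `r`
  have e1 : ⟪r, transversalProj (classFreq n ℓ z)
        (Torus.symbT ((1 / (n : ℝ) ^ 2) • Torus.majorTranspose 𝔸) (classFreq n ℓ z) (transversalProj (classFreq n ℓ z) y))⟫_ℂ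
      = ⟪transversalProj (classFreq n ℓ z) r,
          Torus.symbT ((1 / (n : ℝ) ^ 2) • Torus.majorTranspose 𝔸) (classFreq n ℓ z) (transversalProj (classFreq n ℓ z) y)⟫_ℂ := by
    rw [← inner_transversalProj_comm]
  have e2 : ⟪r, transversalProj (classFreq n ℓ z) (transversalProj z (Torus.symbT (Torus.majorTranspose 𝔸) z (transversalProj z y)))⟫_ℂ
      = ⟪transversalProj z r, Torus.symbT (Torus.majorTranspose 𝔸) z (transversalProj z y)⟫_ℂ := by
    rw [← inner_transversalProj_comm, hr, ← inner_transversalProj_comm]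
  rw [inner_smul_right, inner_sub_right, e1, e2, Complex.re_ofReal_mul, Complex.sub_re, abs_mul, abs_of_pos (by positivity)]
  exact mul_le_mul_of_nonneg_left h (by positivity)

/-! ## §2 Shift bookkeeping on the box -/

/-- `‖coordL_w y‖² = Σ_{u ∈ box} [u = w]·‖y_u‖²`. [cite: MajdaKramer1999, §2.2.1.3] -/
theorem norm_sq_coordL_eq_sum {R : ℕ} (w : Fin 3 → ℤ) (y : Space R) :
    ‖coordL R w y‖ ^ 2 = ∑ u : box R, if (u : Fin 3 → ℤ) = w then ‖y u‖ ^ 2 else 0 := by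
  classical
  by_cases hw : w ∈ box R
  · rw [coordL_apply_of_mem hw, Finset.sum_eq_single (⟨w, hw⟩ : box R)]
    · simp
    · intro u _ hu
      have : (u : Fin 3 → ℤ) ≠ w := fun h => hu (Subtype.ext h)
      simp [this]
    · intro h; exact absurd (Finset.mem_univ _) h
  · rw [coordL_apply_of_not_mem hw, norm_zero]
    symm
    rw [zero_pow two_ne_zero]
    refine Finset.sum_eq_zero fun u _ => ?_
    have : (u : Fin 3 → ℤ) ≠ w := fun h => hw (h ▸ u.2)
    simp [this]

/-- **A shift reads every amplitude at most once**: `Σ_z ‖coordL_{z−m} y‖² ≤ ‖y‖²`. [cite: MajdaKramer1999, §2.2.1.3] -/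
theorem sum_norm_sq_coordL_sub_le {R : ℕ} (m : Fin 3 → ℤ) (y : Space R) :
    ∑ z : box R, ‖coordL R (z.1 - m) y‖ ^ 2 ≤ ‖y‖ ^ 2 := by
  classical
  rw [PiLp.norm_sq_eq_of_L2]
  simp_rw [norm_sq_coordL_eq_sum]
  rw [Finset.sum_comm]
  refine Finset.sum_le_sum fun u _ => ?_
  have hcond : ∀ z : box R, ((u : Fin 3 → ℤ) = z.1 - m) = ((z : Fin 3 → ℤ) = u.1 + m) := by
    intro z; apply propext; constructor <;> intro h
    · rw [h]; abel
    · rw [h]; abel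
  simp_rw [hcond]
  have h1 := sum_ite_coe_eq_le_one R (u.1 + m)
  have hnn : 0 ≤ ‖y u‖ ^ 2 := sq_nonneg _
  calc ∑ z : box R, (if (z : Fin 3 → ℤ) = u.1 + m then ‖y u‖ ^ 2 else 0)
      = (∑ z : box R, (if (z : Fin 3 → ℤ) = u.1 + m then (1:ℝ) else 0)) * ‖y u‖ ^ 2 := by
        rw [Finset.sum_mul]; refine Finset.sum_congr rfl fun z _ => ?_; split_ifs <;> simp
    _ ≤ 1 * ‖y u‖ ^ 2 := mul_le_mul_of_nonneg_right h1 hnn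
    _ = ‖y u‖ ^ 2 := one_mul _

/-- `Σ_z ‖coordL_{z+m} y‖² ≤ ‖y‖²`. [cite: MajdaKramer1999, §2.2.1.3] -/
theorem sum_norm_sq_coordL_add_le {R : ℕ} (m : Fin 3 → ℤ) (y : Space R) :
    ∑ z : box R, ‖coordL R (z.1 + m) y‖ ^ 2 ≤ ‖y‖ ^ 2 := by
  have h := sum_norm_sq_coordL_sub_le (-m) y
  simpa [sub_neg_eq_add] using h

/-- **Cauchy–Schwarz + shift**: `Σ_z ‖r_z‖·‖coordL_{z−m} y‖ ≤ ‖r‖·‖y‖`. [folklore] -/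
theorem sum_norm_mul_norm_coordL_sub_le {R : ℕ} (m : Fin 3 → ℤ) (r y : Space R) :
    ∑ z : box R, ‖r z‖ * ‖coordL R (z.1 - m) y‖ ≤ ‖r‖ * ‖y‖ := by
  have hcs := Real.sum_mul_le_sqrt_mul_sqrt (Finset.univ : Finset (box R)) (fun z => ‖r z‖) (fun z => ‖coordL R (z.1 - m) y‖)
  have hr : Real.sqrt (∑ z : box R, ‖r z‖ ^ 2) = ‖r‖ := by rw [← PiLp.norm_sq_eq_of_L2, Real.sqrt_sq (norm_nonneg _)]
  have hy : Real.sqrt (∑ z : box R, ‖coordL R (z.1 - m) y‖ ^ 2) ≤ ‖y‖ := by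
    rw [← Real.sqrt_sq (norm_nonneg y)]
    exact Real.sqrt_le_sqrt (sum_norm_sq_coordL_sub_le m y)
  rw [hr] at hcs
  exact hcs.trans (mul_le_mul_of_nonneg_left hy (norm_nonneg _))

/-- `Σ_z ‖r_z‖·‖coordL_{z+m} y‖ ≤ ‖r‖·‖y‖`. [folklore] -/
theorem sum_norm_mul_norm_coordL_add_le {R : ℕ} (m : Fin 3 → ℤ) (r y : Space R) :
    ∑ z : box R, ‖r z‖ * ‖coordL R (z.1 + m) y‖ ≤ ‖r‖ * ‖y‖ := by
  have h := sum_norm_mul_norm_coordL_sub_le (-m) r y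
  simpa [sub_neg_eq_add] using h

/-- **Summing a per-neighbour link bound over the box**: if `‖E_z‖ ≤ c·(‖coordL_{z−m} y‖ + ‖coordL_{z+m} y‖)` for every `z`, then
`Σ_z ‖r_z‖·‖E_z‖ ≤ 2c·‖r‖·‖y‖`. [folklore] -/
theorem sum_norm_mul_le_of_neighbour_bound {R : ℕ} (m : Fin 3 → ℤ) (r y : Space R) {E : box R → EuclideanSpace ℂ (Fin 3)} {c : ℝ}
    (hc : 0 ≤ c) (hE : ∀ z : box R, ‖E z‖ ≤ c * (‖coordL R (z.1 - m) y‖ + ‖coordL R (z.1 + m) y‖)) :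
    ∑ z : box R, ‖r z‖ * ‖E z‖ ≤ 2 * c * (‖r‖ * ‖y‖) := by
  have h1 := sum_norm_mul_norm_coordL_sub_le m r y
  have h2 := sum_norm_mul_norm_coordL_add_le m r y
  calc ∑ z : box R, ‖r z‖ * ‖E z‖ ≤ ∑ z : box R, ‖r z‖ * (c * (‖coordL R (z.1 - m) y‖ + ‖coordL R (z.1 + m) y‖)) :=
        Finset.sum_le_sum fun z _ => mul_le_mul_of_nonneg_left (hE z) (norm_nonneg _)
    _ = c * (∑ z : box R, ‖r z‖ * ‖coordL R (z.1 - m) y‖ + ∑ z : box R, ‖r z‖ * ‖coordL R (z.1 + m) y‖) := by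
        rw [← Finset.sum_add_distrib, Finset.mul_sum]
        exact Finset.sum_congr rfl fun z _ => by ring
    _ ≤ c * (‖r‖ * ‖y‖ + ‖r‖ * ‖y‖) := mul_le_mul_of_nonneg_left (add_le_add h1 h2) hc
    _ = 2 * c * (‖r‖ * ‖y‖) := by ring

end Summit.AnomalousDissipation.AnomalousDissipation.Theorems.SolenoidalFractalHomogenisation.LagrangianStep.Sideband

end
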